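import Summits.QuantumFields.BalabanUV.Beta.GAN24.ChainTableLegCoClosed

/-!
# `BalabanUV.Beta.GAN24.PsiSeamSupport` — binder row G-an2-4 ∕ (CONV-C), W-slot CT-W, route «WC-TL» ∕ (Q-R) «QR-LL», row **(LT-Δ) «LAYER TRANSPORT»**, K-LL-4′ (kernel half),
# structural record: **THE COMPOSITE DRESSING's ACCUMULATED GAUGE `Ψ` IS SEAM-SUPPORTED — INSIDE `Lc`-BLOCKS THE DRESSED CHAIN OF LEGS IS THE ONE-SHOT DRESSED COMPOSITE
# COLUMN, EXACTLY, `k`-FREE** (the kernel-side twin of leaf-01 g67's table identities `ChainTableLegCoClosed` §2–§3: there the intermediate levels' gauges die against a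
# co-closed ∕ flux-free LETTER; here they die on every intra-block BOND, whatever the letter — the OWNER gan24-p1 g30: «THIS SHAPE, GO», journal l.46126)

NOT IN PRINT; OUR BOOKKEEPING ([folklore] two-line identities over leaf-01 g67's `ChainTableLegCoClosed.Psi_eq_blk` (`Ψ` reads only `blk Lc u`), leaf-01 g58's
`ContactKernelCells.legChain_respStepBmSeq_apply_eq_add_dz` (`T = U + dz(Ψ(δ) − bmGaugeAt U)`), the OWNER's `RespStepBm.respStepBm_def` ⨾ `AxProjBmWindow.axProjBmAt_eq_coProjBmW`
(the window IS the block-mean axial projector); G-an2-4 formalisation swarm, leaf prover `b2b-balaban-gan24-formalise-leaf-01`, gen 68).  HONEST FRAMING (cell contract, verbatim):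
«discharging `BetaPertH` makes Bałaban's UV stability UNCONDITIONAL — a real constructive-QFT result; it is NOT the continuum limit and NOT the Clay problem.»  HONEST DEPENDENCY
(verbatim): «continuum YM on T⁴ ⇐ BetaPertH ∧ nine spine estimates (0/9 proved); BetaPertH ⇐ (D1) ∧ (D4) ∧ CAP+tail; G-an2-4 gates asym, D1 and NE2/3/4.»

## What (generic `d`, in-block root `toSite rr`; a fine bond `(κ, u)` is INTRA-BLOCK iff `blk Lc (u + e_κ) = blk Lc u`)
§1 **`dz_Psi_eq_zero_of_blk_eq`**: `blk Lc (u + e_κ) = blk Lc u ⇒ dz (Psi ρ Lc m k b) κ u = 0` — the accumulated gauge of the `k` intermediate levels is constant on `Lc`-blocks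
   (it reads `blk (Lc^(i+1)) u = blk (Lc^i) (blk Lc u)`), so its gradient lives on the block SEAMS only.
§2 `respStepBm_apply_eq_sub_dz`: the one-shot dressed column, pointwise: `respStepBm ρ Lc M N′ μ z κ u = respStep M N′ μ z κ u − dz (bmGaugeAt ρ (respStep M N′ μ z) Lc) κ u`.
§3 **`legChain_respStepBmSeq_apply_eq_respStepBm_of_blk_eq`**: on an intra-block bond,
   `legChain (respStepBmSeq ρ Lc) m k μ z κ u = respStepBm ρ Lc (Lc^m) (Lc^(m+k+1)) μ z κ u` — the dressed CHAIN of `k+1` one-step legs equals the ONE-SHOT dressed composite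
   column (the `k = 0` dressing formula applied to the composite undressed column) EXACTLY, for every depth `k`: inside blocks the intermediate levels are invisible;
   `legChain_sub_respStepBm_apply_eq_zero_of_blk_eq` (difference form).
READING (K-LL-4′, located; nothing claimed beyond the identities): a kernel one-gauge cell `push₃ (T − U) …` evaluated on a letter whose kernel bonds are intra-block sees ONLY the
finest-level axial dressing `−dz bmGaugeAt(U)` (rough at the fine scale: `T ≡ 0` on tree bonds), never `Ψ`; the `k`-dependence of the dressed chain — hence every seam count of
leaf-01 g65∕g66 (KLL4-CELLS) and the OWNER's R-g29-1 — is carried by the bonds CROSSING `Lc`-faces alone.  [folklore]; 0 cited facts, 0 `def`, 0 `def … : Prop`, 0 sorry.  NOTHING of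
(Q-R)∕(LT)∕(LAY)∕(S)∕(DIV)∕(DL)∕K-LL-4′ discharged; NEVER «G-an2-4 closed» as (CONV-C); NOT D1, NOT `BetaPertH`, NOT continuum, NOT Clay.  2026-08-22; no existing file touched.
-/

noncomputable section

open Finset
open scoped BigOperators
open Literature.MathematicalPhysics.QuantumFieldTheory
open Literature.MathematicalPhysics.QuantumFieldTheory.Balaban1983to89
open Literature.MathematicalPhysics.QuantumFieldTheory.Balaban1983to89.Beta
open ExpKernelCalculus (Site)
open AffineAveraging (Form1 box toSite dz)
open AffineReproduction (dz_sub)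
open AveragingContours (blk grad_eq_dz)
open KKTFluctuationKernel (delta1)
open BalabanCompositeJets (respStep)
open Summit.QuantumFields.BalabanUV.Beta.AxialProjectorBlockMean (bmGaugeAt axProjBmAt)
open Summit.QuantumFields.BalabanUV.Beta.GAN24.Push4Iter (legChain)
open Summit.QuantumFields.BalabanUV.Beta.GAN24.RespStepBm (bmW respStepBm respStepBm_def)
open Summit.QuantumFields.BalabanUV.Beta.GAN24.RespStepBmDecompExact (respStepBmSeq)
open Summit.QuantumFields.BalabanUV.Beta.GAN24.RespStepBmDecompPsi (Psi)
open Summit.QuantumFields.BalabanUV.Beta.GAN24.ContactKernelCells (legChain_respStepBmSeq_apply_eq_add_dz)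
open Summit.QuantumFields.BalabanUV.Beta.GAN24.AxProjBmWindow (axProjBmAt_eq_coProjBmW)
open Summit.QuantumFields.BalabanUV.Beta.GAN24.ChainTableLegCoClosed (Psi_eq_blk)

namespace Summit.QuantumFields.BalabanUV.Beta.GAN24.PsiSeamSupport

variable {d : ℕ} {Lc : ℕ} [NeZero Lc]

/-! ## §1 `Ψ` is constant on `Lc`-blocks: its gradient is seam-supported -/

/-- NOT IN PRINT; OUR BOOKKEEPING (`ChainTableLegCoClosed.Psi_eq_blk`).  **THE ACCUMULATED GAUGE HAS NO GRADIENT ON INTRA-BLOCK BONDS**: if the bond `(κ, u)` stays inside one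
`Lc`-block (`blk Lc (u + e_κ) = blk Lc u`) then `dz (Psi ρ Lc m k b) κ u = 0`, for every depth `k` and every datum `b`. -/
theorem dz_Psi_eq_zero_of_blk_eq (ρ : Fin (d + 1) → ℤ) (m k : ℕ) (b : Form1 (d + 1) ℝ) {κ : Fin (d + 1)} {u : Site (d + 1)}
    (h : blk Lc (u + AffineAveraging.unitVec κ) = blk Lc u) : dz (Psi ρ Lc m k b) κ u = 0 := by
  show Psi ρ Lc m k b (u + AffineAveraging.unitVec κ) - Psi ρ Lc m k b u = 0
  rw [Psi_eq_blk ρ m k b (u + AffineAveraging.unitVec κ), Psi_eq_blk ρ m k b u, h, sub_self]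

/-! ## §2 The one-shot dressed column, pointwise -/

/-- [folklore] (`respStepBm_def` ⨾ `bmW` ⨾ `axProjBmAt_eq_coProjBmW` ⨾ `axProjBmAt` ⨾ `grad_eq_dz`).  **THE ONE-SHOT DRESSED COLUMN IS THE UNDRESSED ONE MINUS THE GRADIENT OF
ITS BLOCK-MEAN AXIAL GAUGE**, pointwise: `respStepBm ρ Lc M N′ μ z κ u = respStep M N′ μ z κ u − dz (bmGaugeAt ρ (respStep M N′ μ z) Lc) κ u` (in-block root `ρ = toSite rr`). -/
theorem respStepBm_apply_eq_sub_dz {rr : Fin (d + 1) → ℕ} (hrr : rr ∈ box (d + 1) Lc) (M N' : ℕ) [NeZero N']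
    (μ : Fin (d + 1)) (z : Site (d + 1)) (κ : Fin (d + 1)) (u : Site (d + 1)) :
    respStepBm (d := d) (toSite rr) Lc M N' μ z κ u
      = respStep (d := d) M N' μ z κ u - dz (bmGaugeAt (toSite rr) (respStep (d := d) M N' μ z) Lc) κ u := by
  have hLc : 1 ≤ Lc := Nat.one_le_iff_ne_zero.2 (NeZero.ne Lc)
  rw [respStepBm_def]
  show bmW (toSite rr) Lc (respStep (d := d) M N') μ z κ u = _
  rw [bmW, ← axProjBmAt_eq_coProjBmW hLc hrr, axProjBmAt, ← grad_eq_dz]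
  rfl

/-! ## §3 Inside blocks the dressed chain is the one-shot dressed composite column, `k`-free -/

/-- NOT IN PRINT; OUR BOOKKEEPING (§1 ⨾ §2 ⨾ `ContactKernelCells.legChain_respStepBmSeq_apply_eq_add_dz`).  **INSIDE `Lc`-BLOCKS THE DRESSED CHAIN OF LEGS IS THE ONE-SHOT
DRESSED COMPOSITE COLUMN, EXACTLY**: for every depth `k`, every source bond `(μ, z)` and every INTRA-BLOCK output bond `(κ, u)`,
`legChain (respStepBmSeq ρ Lc) m k μ z κ u = respStepBm ρ Lc (Lc^m) (Lc^(m+k+1)) μ z κ u` — the `k` intermediate levels' gauges `Ψ` are invisible off the seams. -/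
theorem legChain_respStepBmSeq_apply_eq_respStepBm_of_blk_eq {rr : Fin (d + 1) → ℕ} (hrr : rr ∈ box (d + 1) Lc) (m k : ℕ)
    (μ : Fin (d + 1)) (z : Site (d + 1)) {κ : Fin (d + 1)} {u : Site (d + 1)} (h : blk Lc (u + AffineAveraging.unitVec κ) = blk Lc u) :
    legChain (respStepBmSeq (d := d) (toSite rr) Lc) m k μ z κ u = respStepBm (d := d) (toSite rr) Lc (Lc ^ m) (Lc ^ (m + k + 1)) μ z κ u := by
  rw [legChain_respStepBmSeq_apply_eq_add_dz hrr m k μ z κ u, dz_sub, Pi.sub_apply, Pi.sub_apply,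
    dz_Psi_eq_zero_of_blk_eq (Lc := Lc) (toSite rr) m k (delta1 μ z) h, zero_sub, respStepBm_apply_eq_sub_dz hrr, sub_eq_add_neg]

/-- NOT IN PRINT; OUR BOOKKEEPING.  **DIFFERENCE FORM**: on an intra-block bond the dressed chain minus the one-shot dressed composite column VANISHES — the gauge leg of the
residual telescope `T − T^{one-shot} = dz Ψ` (cf. `ChainTableLegTelescopeCell.push₃_chain_sub_respStepBm_eq_zero_of_fluxFree`, where it dies against a flux-free letter instead). -/
theorem legChain_sub_respStepBm_apply_eq_zero_of_blk_eq {rr : Fin (d + 1) → ℕ} (hrr : rr ∈ box (d + 1) Lc) (m k : ℕ)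
    (μ : Fin (d + 1)) (z : Site (d + 1)) {κ : Fin (d + 1)} {u : Site (d + 1)} (h : blk Lc (u + AffineAveraging.unitVec κ) = blk Lc u) :
    legChain (respStepBmSeq (d := d) (toSite rr) Lc) m k μ z κ u - respStepBm (d := d) (toSite rr) Lc (Lc ^ m) (Lc ^ (m + k + 1)) μ z κ u = 0 := by
  rw [legChain_respStepBmSeq_apply_eq_respStepBm_of_blk_eq hrr m k μ z h, sub_self]

end Summit.QuantumFields.BalabanUV.Beta.GAN24.PsiSeamSupport

end
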